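import Mathlib
import HarnessLib
import Literature.MathematicalPhysics.QuantumLattice.HubbardSliceSymbolSmoothMomentum
import Summits.HubbardSuperconductivity.HubbardSuperconductivity.Theorems.KLProgrammeC4aTubeTadpole

/-!
# Route `KLProgramme` — crux C4a, the VALUE LAYER (L2-val) of the tube tadpole: odd pairing of the slice profile against the
# angular average of the vertex — the `k = 0` law `U²·16^{−n}` (memo HOME/hubbard-kl-c4a-1/C4A-PLAN.md §17)

Cell `gate-hubbard-kl`, lane hubbard-kl-c4a-1 (g4); helper for the engine-flow child `KLRegimeEngineV17F2` (stmt-HubbardSuperconductivity-20437),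
stub (C) `stub_twoLeg_curvature`, its `k = 0` clause and the appended mean-free conjunct `TwoLegReadOscAt` (token #26, (R59bg)/(K5′)).

WHY.  The tube tadpole-JET theorem (`…C4aTubeTadpole.norm_iteratedDeriv_tubeTadpole_le*`, `…C4aCoMovingJetsL1`) bounds every angular jet of
`T(θ) = ∫_{tube} f(e_K q)·V(Φ(0,θ), q) dq` by Jacobian jets × co-moving `L¹(dϑ)` dominators × the slice MASS `∫|f|` — size `≍ Λ_n`: at `k = 0` this is
the law `4^{−n}`, one power short of the slot's `16^{−n}`.  The missing power is a SIGN property of the slice, not a size property: the slice symbol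
`ŝ(q₀, ξ) = W(q₀,ξ)·c/(ξ − iq₀)` (`sliceSymbolFnXi c 0 Λ Λ′ q₀ ξ`) is ODD under `(q₀, ξ) ↦ (−q₀, −ξ)` (`W` even), so against a level-profile that is odd in
this sense the tadpole only sees the ODD-DIFFERENCE of the angular average `G_θ(ρ) = ∫dϑ J(ρ,ϑ)·V(Φ(0,θ), Φ(ρ,ϑ))` between the levels `±ρ`
(and the frequencies `±q₀`), which is `O(|ρ| + |q₀|)` with an `n`-FREE constant for the fat vertices ((L3-val): near field `∇B(0) = 0` and far
field principal value, both by inversion symmetry; the Hartree part by the radial derivative of the level density).  One more factor `Λ_n`.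

* §1 one-dimensional odd pairing: `setIntegral_Ioo_symm_comp_neg` (the level range is symmetric), `setIntegral_pair_eq` (two profiles `fp, fm`
  with `fm(−ρ) = −fp(ρ)`: `∫fpgp + ∫fmgm = ∫ fp(ρ)·(gp(ρ) − gm(−ρ))`), `norm_setIntegral_pair_le`, and the single odd profile
  `norm_setIntegral_mul_le_of_odd` (`‖∫ f g‖ ≤ ½∫‖f(ρ)‖·‖g(ρ) − g(−ρ)‖`); `norm_sub_comp_neg_le_of_deriv` (mean value: a radial derivative bound
  `‖g′‖ ≤ D` on `(−r,r)` gives `‖g(ρ) − g(−ρ)‖ ≤ 2D|ρ|`);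
* §2 Fubini on the chart box: `tubeTadpole_eq_setIntegral_angularAvg` — `T(θ) = ∫_{(−r,r)} f(ρ)·G_θ(ρ) dρ` with the ANGULAR AVERAGE
  `G_θ(ρ) = ∫_{(0,2π]} J(ρ,ϑ) • V(Φ(0,θ), Φ(ρ,ϑ)) dϑ`;
* §3 THE VALUE THEOREMS: `norm_tubeTadpole_pair_le` (two profiles/two vertices — the Matsubara pair `±q₀`: `‖Tp(θ) + Tm(θ)‖ ≤ ∫‖fp(ρ)‖·d(ρ)` whenever
  `‖Gp_θ(ρ) − Gm_θ(−ρ)‖ ≤ d(ρ)` on the level range), `norm_tubeTadpole_le_of_odd` (one odd profile: `‖T(θ)‖ ≤ ½∫‖f‖·d`), and the linear-modulus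
  instance `norm_tubeTadpole_le_of_odd_of_lipschitz` (`d(ρ) = 2D|ρ|` ⇒ `‖T(θ)‖ ≤ D·∫‖f(ρ)‖·|ρ|` — first radial MOMENT of the slice, `≍ Λ_n²`);
* §4 `tubeTadpole_const_vertex` (a θ-blind vertex gives a θ-CONSTANT tadpole — the Hartree term drops from every oscillation/jet EXACTLY) and the
  Hartree value `norm_tubeTadpole_const_le` (odd profile × radial odd-difference of the level density `∫dϑ J(ρ,ϑ)`).

Pure calculus on the tree's objects (`levelChartJac`, `levelPoint`, `tubeTadpole_eq_chart`); nothing is asserted about the Hubbard model — the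
(L3-val) dominators `d` of the fat vertices and the radial level-density modulus are the named inputs.  References: FST II CPAM 51 (1998) 1133 §3;
BGM 2006 §2.4 (2.36) [cite: BenfattoGiulianiMastropietro2006] (`C₀|U|γ^{2h}`-type value law: the tadpole of an odd slice sees only the derivative
of the density of states).
-/

noncomputable section

namespace Summit.HubbardSuperconductivity.HubbardSuperconductivity.Theorems.C4a

set_option linter.dupNamespace false -- summit = problem name (single-conjunct summit), D-0017

open Real Set MeasureTheory Filter
open scoped ContDiff Topology
open Literature.MathematicalPhysics.QuantumLattice Literature.MathematicalPhysics.QuantumLattice.BandSectorCounting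
open Summit.HubbardSuperconductivity.HubbardSuperconductivity.Theorems.DispersionFlow
open Summit.HubbardSuperconductivity.HubbardSuperconductivity.Theorems.KLRegimeSplit
open Summit.HubbardSuperconductivity.HubbardSuperconductivity.Theorems.PerturbedFermiCurve

/-! ## §1 One-dimensional odd pairing on a symmetric level range -/

section OneD

variable {E : Type*} [NormedAddCommGroup E] [NormedSpace ℝ E]

/-- **The level range `(−r, r)` is symmetric**: `∫_{(−r,r)} h(−x) dx = ∫_{(−r,r)} h(x) dx`. -/
theorem setIntegral_Ioo_symm_comp_neg (r : ℝ) (h : ℝ → E) :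
    ∫ x in Ioo (-r) r, h (-x) = ∫ x in Ioo (-r) r, h x := by
  have A : MeasurableEmbedding fun x : ℝ => -x := (Homeomorph.neg ℝ).isClosedEmbedding.measurableEmbedding
  have := MeasurableEmbedding.setIntegral_map (μ := volume) A h (Ioo (-r) r)
  rw [Measure.map_neg_eq_self (volume : Measure ℝ)] at this
  rw [this, neg_preimage, neg_Ioo, neg_neg]

/-- **Odd pairing of two profiles.**  If `fm(−ρ) = −fp(ρ)` (the Matsubara pair `±q₀` of the slice symbol: `ŝ(−q₀, −ξ) = −ŝ(q₀, ξ)`), then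
`∫ fp·gp + ∫ fm·gm = ∫ fp(ρ)·(gp(ρ) − gm(−ρ)) dρ` over the symmetric level range. -/
theorem setIntegral_pair_eq {r : ℝ} {fp fm : ℝ → ℂ} {gp gm : ℝ → ℂ} (hodd : ∀ ρ, fm (-ρ) = -fp ρ)
    (hp : IntegrableOn (fun ρ => fp ρ * gp ρ) (Ioo (-r) r)) (hm : IntegrableOn (fun ρ => fm ρ * gm ρ) (Ioo (-r) r)) :
    (∫ ρ in Ioo (-r) r, fp ρ * gp ρ) + (∫ ρ in Ioo (-r) r, fm ρ * gm ρ) =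
      ∫ ρ in Ioo (-r) r, fp ρ * (gp ρ - gm (-ρ)) := by
  have hneg : (∫ ρ in Ioo (-r) r, fm ρ * gm ρ) = ∫ ρ in Ioo (-r) r, -(fp ρ * gm (-ρ)) := by
    rw [← setIntegral_Ioo_symm_comp_neg r (fun ρ => fm ρ * gm ρ)]
    refine setIntegral_congr_fun measurableSet_Ioo fun ρ _ => ?_
    simp only [hodd ρ, neg_mul]
  have hm' : IntegrableOn (fun ρ => -(fp ρ * gm (-ρ))) (Ioo (-r) r) := by
    have A : MeasurableEmbedding fun x : ℝ => -x := (Homeomorph.neg ℝ).isClosedEmbedding.measurableEmbedding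
    have h1 : IntegrableOn (fun ρ => fm (-ρ) * gm (-ρ)) (Ioo (-r) r) := by
      have := (A.integrableOn_map_iff (μ := volume) (f := fun ρ => fm ρ * gm ρ) (s := Ioo (-r) r)).1
      rw [Measure.map_neg_eq_self (volume : Measure ℝ)] at this
      have h2 := this hm
      rw [neg_preimage, neg_Ioo, neg_neg] at h2
      exact h2
    refine h1.congr_fun (fun ρ _ => ?_) measurableSet_Ioo
    simp only [hodd ρ, neg_mul]
  rw [hneg, ← integral_add hp hm']
  refine setIntegral_congr_fun measurableSet_Ioo fun ρ _ => ?_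
  ring

/-- **Odd pairing, norm form**: `‖∫ fpgp + ∫ fmgm‖ ≤ ∫ ‖fp(ρ)‖·‖gp(ρ) − gm(−ρ)‖ dρ`. -/
theorem norm_setIntegral_pair_le {r : ℝ} {fp fm : ℝ → ℂ} {gp gm : ℝ → ℂ} (hodd : ∀ ρ, fm (-ρ) = -fp ρ)
    (hp : IntegrableOn (fun ρ => fp ρ * gp ρ) (Ioo (-r) r)) (hm : IntegrableOn (fun ρ => fm ρ * gm ρ) (Ioo (-r) r)) :
    ‖(∫ ρ in Ioo (-r) r, fp ρ * gp ρ) + (∫ ρ in Ioo (-r) r, fm ρ * gm ρ)‖ ≤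
      ∫ ρ in Ioo (-r) r, ‖fp ρ‖ * ‖gp ρ - gm (-ρ)‖ := by
  rw [setIntegral_pair_eq hodd hp hm]
  refine (norm_integral_le_integral_norm _).trans (le_of_eq ?_)
  refine integral_congr_ae (Filter.Eventually.of_forall fun ρ => ?_)
  simp only [norm_mul]

/-- **Odd pairing against a dominator**: if moreover `‖gp(ρ) − gm(−ρ)‖ ≤ d(ρ)` on the level range and `‖fp‖·d` is integrable there, then
`‖∫ fpgp + ∫ fmgm‖ ≤ ∫ ‖fp(ρ)‖·d(ρ) dρ`. -/
theorem norm_setIntegral_pair_le_of_dom {r : ℝ} {fp fm : ℝ → ℂ} {gp gm : ℝ → ℂ} {d : ℝ → ℝ} (hodd : ∀ ρ, fm (-ρ) = -fp ρ)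
    (hp : IntegrableOn (fun ρ => fp ρ * gp ρ) (Ioo (-r) r)) (hm : IntegrableOn (fun ρ => fm ρ * gm ρ) (Ioo (-r) r))
    (hd : ∀ ρ ∈ Ioo (-r) r, ‖gp ρ - gm (-ρ)‖ ≤ d ρ) (hfd : IntegrableOn (fun ρ => ‖fp ρ‖ * d ρ) (Ioo (-r) r)) :
    ‖(∫ ρ in Ioo (-r) r, fp ρ * gp ρ) + (∫ ρ in Ioo (-r) r, fm ρ * gm ρ)‖ ≤ ∫ ρ in Ioo (-r) r, ‖fp ρ‖ * d ρ := by
  refine (norm_setIntegral_pair_le hodd hp hm).trans ?_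
  refine integral_mono_of_nonneg (Filter.Eventually.of_forall fun ρ => by positivity) hfd ?_
  filter_upwards [ae_restrict_mem measurableSet_Ioo] with ρ hρ
  exact mul_le_mul_of_nonneg_left (hd ρ hρ) (norm_nonneg _)

/-- **Single odd profile**: `f(−ρ) = −f(ρ)` ⟹ `‖∫_{(−r,r)} f·g‖ ≤ ½ ∫ ‖f(ρ)‖·‖g(ρ) − g(−ρ)‖ dρ`. -/
theorem norm_setIntegral_mul_le_of_odd {r : ℝ} {f g : ℝ → ℂ} (hodd : ∀ ρ, f (-ρ) = -f ρ)
    (h : IntegrableOn (fun ρ => f ρ * g ρ) (Ioo (-r) r)) :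
    ‖∫ ρ in Ioo (-r) r, f ρ * g ρ‖ ≤ (1 / 2) * ∫ ρ in Ioo (-r) r, ‖f ρ‖ * ‖g ρ - g (-ρ)‖ := by
  have h2 := norm_setIntegral_pair_le (fp := f) (fm := f) (gp := g) (gm := g) hodd h h
  rw [← two_smul ℝ (∫ ρ in Ioo (-r) r, f ρ * g ρ), norm_smul, Real.norm_two] at h2
  linarith

/-- Single odd profile against a dominator: `‖g(ρ) − g(−ρ)‖ ≤ d(ρ)` ⟹ `‖∫ f g‖ ≤ ½∫‖f‖·d`. -/
theorem norm_setIntegral_mul_le_of_odd_of_dom {r : ℝ} {f g : ℝ → ℂ} {d : ℝ → ℝ} (hodd : ∀ ρ, f (-ρ) = -f ρ)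
    (h : IntegrableOn (fun ρ => f ρ * g ρ) (Ioo (-r) r)) (hd : ∀ ρ ∈ Ioo (-r) r, ‖g ρ - g (-ρ)‖ ≤ d ρ)
    (hfd : IntegrableOn (fun ρ => ‖f ρ‖ * d ρ) (Ioo (-r) r)) :
    ‖∫ ρ in Ioo (-r) r, f ρ * g ρ‖ ≤ (1 / 2) * ∫ ρ in Ioo (-r) r, ‖f ρ‖ * d ρ := by
  have h2 := norm_setIntegral_pair_le_of_dom (fp := f) (fm := f) (gp := g) (gm := g) hodd h h hd hfd
  rw [← two_smul ℝ (∫ ρ in Ioo (-r) r, f ρ * g ρ), norm_smul, Real.norm_two] at h2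
  linarith

/-- **Mean value ⇒ linear odd-difference modulus**: a function differentiable on `(−r, r)` with `‖g′‖ ≤ D` there satisfies
`‖g(ρ) − g(−ρ)‖ ≤ 2D·|ρ|` for `|ρ| < r`. -/
theorem norm_sub_comp_neg_le_of_deriv {r D : ℝ} {g : ℝ → E} (hg : DifferentiableOn ℝ g (Ioo (-r) r))
    (hD : ∀ x ∈ Ioo (-r) r, ‖deriv g x‖ ≤ D) {ρ : ℝ} (hρ : ρ ∈ Ioo (-r) r) :
    ‖g ρ - g (-ρ)‖ ≤ 2 * D * |ρ| := by
  have hρ' : -ρ ∈ Ioo (-r) r := ⟨by linarith [hρ.2], by linarith [hρ.1]⟩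
  have hconv : Convex ℝ (Ioo (-r) r) := convex_Ioo _ _
  have key := hconv.norm_image_sub_le_of_norm_deriv_le (fun x hx => hg.differentiableAt (Ioo_mem_nhds hx.1 hx.2)) hD hρ' hρ
  calc ‖g ρ - g (-ρ)‖ ≤ D * ‖ρ - -ρ‖ := key
    _ = 2 * D * |ρ| := by rw [sub_neg_eq_add, ← two_mul, norm_mul, Real.norm_two, Real.norm_eq_abs]; ring

end OneD

/-! ## §2 The angular average and Fubini on the chart box -/

/-- **The ANGULAR AVERAGE of the chart-side vertex factor at level `ρ`**, read from the curve point of angle `θ`: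
`tubeAngularAvg μ K V θ ρ = ∫_{(0,2π]} J(ρ,ϑ) • V(Φ(0,θ), Φ(ρ,ϑ)) dϑ` (`J = levelChartJac μ K`, `Φ = levelPoint μ K`).  The (L3-val) interface:
consumers bound the odd-difference `‖tubeAngularAvg … Vp θ ρ − tubeAngularAvg … Vm θ (−ρ)‖` on the level range, uniformly in `θ`. -/
def tubeAngularAvg (μ : ℝ) (K : TrigPolyC4v) (V : Momentum → Momentum → ℂ) (θ ρ : ℝ) : ℂ :=
  ∫ ϑ in Ioc 0 (2 * π), levelChartJac μ K (ρ, ϑ) • V (levelPoint μ K 0 θ) (levelPoint μ K ρ ϑ)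

/-- Unfolding `tubeAngularAvg`. -/
theorem tubeAngularAvg_apply (μ : ℝ) (K : TrigPolyC4v) (V : Momentum → Momentum → ℂ) (θ ρ : ℝ) :
    tubeAngularAvg μ K V θ ρ = ∫ ϑ in Ioc 0 (2 * π), levelChartJac μ K (ρ, ϑ) • V (levelPoint μ K 0 θ) (levelPoint μ K ρ ϑ) := rfl

/-- A θ-blind vertex has a θ-free angular average. -/
theorem tubeAngularAvg_of_blind {μ : ℝ} {K : TrigPolyC4v} {V : Momentum → Momentum → ℂ} {V₀ : Momentum → ℂ}
    (hV : ∀ k q, V k q = V₀ q) (θ θ' ρ : ℝ) : tubeAngularAvg μ K V θ ρ = tubeAngularAvg μ K V θ' ρ := by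
  simp only [tubeAngularAvg, hV]

/-- The angular average of a CONSTANT vertex is the constant times the level density `∫_{(0,2π]} J(ρ,ϑ) dϑ`. -/
theorem tubeAngularAvg_const (μ : ℝ) (K : TrigPolyC4v) (c : ℂ) (θ ρ : ℝ) :
    tubeAngularAvg μ K (fun _ _ => c) θ ρ = (∫ ϑ in Ioc 0 (2 * π), levelChartJac μ K (ρ, ϑ)) • c := by
  rw [tubeAngularAvg, integral_smul_const]

section Chart

variable {a b : ℝ} (B : BandBounds a b) {K : TrigPolyC4v} {A : ℝ}
  (hA : ∀ p : Momentum, ∀ j ≤ 2, ‖iteratedFDeriv ℝ j (frameShift K) p‖ ≤ A) (hADt : 2 * A < B.Dtmin)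
  {μ r : ℝ} (hlo : a < μ - r - A) (hhi : μ + r + A < b)
include B hA hADt hlo hhi

/-- The chart-side integrand is integrable on the chart box (continuous on the plane, …C4aTubeTadpole `continuous_chartIntegrand`). -/
theorem integrableOn_chartIntegrand_box {f : ℝ → ℂ} (hf : ContDiff ℝ ∞ f) (hfsupp : tsupport f ⊆ Ioo (-r) r)
    {V : Momentum → Momentum → ℂ} (hV : ContDiff ℝ ∞ fun x : Momentum × Momentum => V x.1 x.2) (θ : ℝ) :
    IntegrableOn (fun p : ℝ × ℝ => f p.1 * (levelChartJac μ K p • V (levelPoint μ K 0 θ) (levelPoint μ K p.1 p.2)))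
      (Ioo (-r) r ×ˢ Ioc 0 (2 * π)) :=
  ((continuous_chartIntegrand B hA hADt hlo hhi hf hfsupp hV θ).continuousOn.integrableOn_compact
    (isCompact_Icc.prod isCompact_Icc)).mono_set (prod_mono Ioo_subset_Icc_self Ioc_subset_Icc_self)

/-- **Fubini**: the level profile times the angular average is integrable on the level range, and
`T(θ) = ∫_{(−r,r)} f(ρ) · tubeAngularAvg μ K V θ ρ dρ`. -/
theorem integrableOn_mul_tubeAngularAvg {f : ℝ → ℂ} (hf : ContDiff ℝ ∞ f) (hfsupp : tsupport f ⊆ Ioo (-r) r)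
    {V : Momentum → Momentum → ℂ} (hV : ContDiff ℝ ∞ fun x : Momentum × Momentum => V x.1 x.2) (θ : ℝ) :
    IntegrableOn (fun ρ => f ρ * tubeAngularAvg μ K V θ ρ) (Ioo (-r) r) := by
  have hprod := integrableOn_chartIntegrand_box B hA hADt hlo hhi hf hfsupp hV θ
  rw [IntegrableOn, Measure.volume_eq_prod, ← Measure.prod_restrict] at hprod
  have h1 := hprod.integral_prod_left
  refine (h1.congr (Filter.Eventually.of_forall fun ρ => ?_))
  simp only [tubeAngularAvg, integral_const_mul]

/-- **The tube tadpole is the level integral of profile × angular average**: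
`∫_{tube} f(e_K q)·V(Φ(0,θ), q) dq = ∫_{(−r,r)} f(ρ)·tubeAngularAvg μ K V θ ρ dρ`. -/
theorem tubeTadpole_eq_setIntegral_angularAvg {f : ℝ → ℂ} (hf : ContDiff ℝ ∞ f) (hfsupp : tsupport f ⊆ Ioo (-r) r)
    {V : Momentum → Momentum → ℂ} (hV : ContDiff ℝ ∞ fun x : Momentum × Momentum => V x.1 x.2) (θ : ℝ) :
    ∫ q in {q : ℝ × ℝ | |q.1| < π ∧ |q.2| < π ∧ |frameLevel μ K (WithLp.toLp 2 ![q.1, q.2])| < r},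
        f (frameLevel μ K (WithLp.toLp 2 ![q.1, q.2])) * V (levelPoint μ K 0 θ) (WithLp.toLp 2 ![q.1, q.2]) =
      ∫ ρ in Ioo (-r) r, f ρ * tubeAngularAvg μ K V θ ρ := by
  rw [tubeTadpole_eq_chart B hA hADt hlo hhi hf hfsupp hV θ]
  have hprod := integrableOn_chartIntegrand_box B hA hADt hlo hhi hf hfsupp hV θ
  rw [Measure.volume_eq_prod] at hprod ⊢
  rw [setIntegral_prod _ hprod]
  refine setIntegral_congr_fun measurableSet_Ioo fun ρ _ => ?_
  simp only [tubeAngularAvg, integral_const_mul]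

end Chart

/-! ## §3 The value theorems -/

section Value

variable {a b : ℝ} (B : BandBounds a b) {K : TrigPolyC4v} {A : ℝ}
  (hA : ∀ p : Momentum, ∀ j ≤ 2, ‖iteratedFDeriv ℝ j (frameShift K) p‖ ≤ A) (hADt : 2 * A < B.Dtmin)
  {μ r : ℝ} (hlo : a < μ - r - A) (hhi : μ + r + A < b)
include B hA hADt hlo hhi

/-- **THE TUBE TADPOLE VALUE THEOREM, paired form (the Matsubara pair `±q₀`).**  Two level profiles with `fm(−ρ) = −fp(ρ)` (the slice symbol at
`∓q₀`), two jointly smooth vertices `Vp, Vm` (the fat vertex at the two frequencies), and a dominator `d` of the ODD-DIFFERENCE of their angular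
averages, `‖tubeAngularAvg … Vp θ ρ − tubeAngularAvg … Vm θ (−ρ)‖ ≤ d(ρ)` on the level range, with `‖fp‖·d` integrable.  Then
`‖Tp(θ) + Tm(θ)‖ ≤ ∫_{(−r,r)} ‖fp(ρ)‖·d(ρ) dρ` — with `d(ρ) = D(|ρ| + |q₀|)` this is the first radial/frequency MOMENT of the slice (`≍ Λ_n²`). -/
theorem norm_tubeTadpole_pair_le {fp fm : ℝ → ℂ} (hfp : ContDiff ℝ ∞ fp) (hfpsupp : tsupport fp ⊆ Ioo (-r) r)
    (hfm : ContDiff ℝ ∞ fm) (hfmsupp : tsupport fm ⊆ Ioo (-r) r) (hodd : ∀ ρ, fm (-ρ) = -fp ρ)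
    {Vp Vm : Momentum → Momentum → ℂ} (hVp : ContDiff ℝ ∞ fun x : Momentum × Momentum => Vp x.1 x.2)
    (hVm : ContDiff ℝ ∞ fun x : Momentum × Momentum => Vm x.1 x.2) (θ : ℝ) {d : ℝ → ℝ}
    (hd : ∀ ρ ∈ Ioo (-r) r, ‖tubeAngularAvg μ K Vp θ ρ - tubeAngularAvg μ K Vm θ (-ρ)‖ ≤ d ρ)
    (hfd : IntegrableOn (fun ρ => ‖fp ρ‖ * d ρ) (Ioo (-r) r)) :
    ‖(∫ q in {q : ℝ × ℝ | |q.1| < π ∧ |q.2| < π ∧ |frameLevel μ K (WithLp.toLp 2 ![q.1, q.2])| < r},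
          fp (frameLevel μ K (WithLp.toLp 2 ![q.1, q.2])) * Vp (levelPoint μ K 0 θ) (WithLp.toLp 2 ![q.1, q.2])) +
        ∫ q in {q : ℝ × ℝ | |q.1| < π ∧ |q.2| < π ∧ |frameLevel μ K (WithLp.toLp 2 ![q.1, q.2])| < r},
          fm (frameLevel μ K (WithLp.toLp 2 ![q.1, q.2])) * Vm (levelPoint μ K 0 θ) (WithLp.toLp 2 ![q.1, q.2])‖ ≤
      ∫ ρ in Ioo (-r) r, ‖fp ρ‖ * d ρ := by
  rw [tubeTadpole_eq_setIntegral_angularAvg B hA hADt hlo hhi hfp hfpsupp hVp θ,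
    tubeTadpole_eq_setIntegral_angularAvg B hA hADt hlo hhi hfm hfmsupp hVm θ]
  exact norm_setIntegral_pair_le_of_dom hodd (integrableOn_mul_tubeAngularAvg B hA hADt hlo hhi hfp hfpsupp hVp θ)
    (integrableOn_mul_tubeAngularAvg B hA hADt hlo hhi hfm hfmsupp hVm θ) hd hfd

/-- **THE TUBE TADPOLE VALUE THEOREM, single odd profile.**  `f(−ρ) = −f(ρ)`, `V` jointly smooth, `‖G_θ(ρ) − G_θ(−ρ)‖ ≤ d(ρ)` for the angular
average `G_θ = tubeAngularAvg μ K V θ` on the level range ⟹ `‖T(θ)‖ ≤ ½ ∫_{(−r,r)} ‖f(ρ)‖·d(ρ) dρ`. -/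
theorem norm_tubeTadpole_le_of_odd {f : ℝ → ℂ} (hf : ContDiff ℝ ∞ f) (hfsupp : tsupport f ⊆ Ioo (-r) r)
    (hodd : ∀ ρ, f (-ρ) = -f ρ) {V : Momentum → Momentum → ℂ} (hV : ContDiff ℝ ∞ fun x : Momentum × Momentum => V x.1 x.2)
    (θ : ℝ) {d : ℝ → ℝ} (hd : ∀ ρ ∈ Ioo (-r) r, ‖tubeAngularAvg μ K V θ ρ - tubeAngularAvg μ K V θ (-ρ)‖ ≤ d ρ)
    (hfd : IntegrableOn (fun ρ => ‖f ρ‖ * d ρ) (Ioo (-r) r)) :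
    ‖∫ q in {q : ℝ × ℝ | |q.1| < π ∧ |q.2| < π ∧ |frameLevel μ K (WithLp.toLp 2 ![q.1, q.2])| < r},
        f (frameLevel μ K (WithLp.toLp 2 ![q.1, q.2])) * V (levelPoint μ K 0 θ) (WithLp.toLp 2 ![q.1, q.2])‖ ≤
      (1 / 2) * ∫ ρ in Ioo (-r) r, ‖f ρ‖ * d ρ := by
  rw [tubeTadpole_eq_setIntegral_angularAvg B hA hADt hlo hhi hf hfsupp hV θ]
  exact norm_setIntegral_mul_le_of_odd_of_dom hodd (integrableOn_mul_tubeAngularAvg B hA hADt hlo hhi hf hfsupp hV θ) hd hfd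

/-- **Linear modulus ⇒ first radial moment.**  If the angular average `ρ ↦ G_θ(ρ)` is differentiable on the level range with `‖G_θ′‖ ≤ D`
(the (L3-val) dominator in derivative form: radial derivative of the angular average of the vertex, uniformly in `θ`), then for an odd profile
`‖T(θ)‖ ≤ D · ∫_{(−r,r)} ‖f(ρ)‖·|ρ| dρ`. -/
theorem norm_tubeTadpole_le_of_odd_of_deriv {f : ℝ → ℂ} (hf : ContDiff ℝ ∞ f) (hfsupp : tsupport f ⊆ Ioo (-r) r)
    (hodd : ∀ ρ, f (-ρ) = -f ρ) {V : Momentum → Momentum → ℂ} (hV : ContDiff ℝ ∞ fun x : Momentum × Momentum => V x.1 x.2)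
    (θ : ℝ) {D : ℝ} (hG : DifferentiableOn ℝ (tubeAngularAvg μ K V θ) (Ioo (-r) r))
    (hD : ∀ ρ ∈ Ioo (-r) r, ‖deriv (tubeAngularAvg μ K V θ) ρ‖ ≤ D) :
    ‖∫ q in {q : ℝ × ℝ | |q.1| < π ∧ |q.2| < π ∧ |frameLevel μ K (WithLp.toLp 2 ![q.1, q.2])| < r},
        f (frameLevel μ K (WithLp.toLp 2 ![q.1, q.2])) * V (levelPoint μ K 0 θ) (WithLp.toLp 2 ![q.1, q.2])‖ ≤
      D * ∫ ρ in Ioo (-r) r, ‖f ρ‖ * |ρ| := by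
  have hfI : IntegrableOn (fun ρ : ℝ => ‖f ρ‖ * |ρ|) (Ioo (-r) r) :=
    (((continuous_norm.comp hf.continuous).mul continuous_abs).continuousOn.integrableOn_compact isCompact_Icc).mono_set
      Ioo_subset_Icc_self
  have h := norm_tubeTadpole_le_of_odd B hA hADt hlo hhi hf hfsupp hodd hV θ (d := fun ρ => 2 * D * |ρ|)
    (fun ρ hρ => norm_sub_comp_neg_le_of_deriv hG hD hρ)
    ((hfI.const_mul (2 * D)).congr (Filter.Eventually.of_forall fun ρ => by simp only; ring))
  refine h.trans (le_of_eq ?_)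
  rw [← integral_const_mul, ← integral_const_mul]
  refine integral_congr_ae (Filter.Eventually.of_forall fun ρ => ?_)
  simp only; ring

end Value

/-! ## §4 The θ-blind vertex: the Hartree term is θ-constant; its value -/

section Const

variable {K : TrigPolyC4v} {μ r : ℝ}

/-- **`tubeTadpole_const_vertex`** — a θ-BLIND vertex (`V k q = V₀ q`: the bare Hubbard `U`, or any vertex not reading the external leg) gives a
θ-CONSTANT tube tadpole: it drops EXACTLY from every angular jet and from the mean-free part of the reading (memo §12.3′ Hartree split). -/
theorem tubeTadpole_const_vertex {f : ℝ → ℂ} {V : Momentum → Momentum → ℂ} {V₀ : Momentum → ℂ} (hV : ∀ k q, V k q = V₀ q)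
    (θ θ' : ℝ) :
    (∫ q in {q : ℝ × ℝ | |q.1| < π ∧ |q.2| < π ∧ |frameLevel μ K (WithLp.toLp 2 ![q.1, q.2])| < r},
        f (frameLevel μ K (WithLp.toLp 2 ![q.1, q.2])) * V (levelPoint μ K 0 θ) (WithLp.toLp 2 ![q.1, q.2])) =
      ∫ q in {q : ℝ × ℝ | |q.1| < π ∧ |q.2| < π ∧ |frameLevel μ K (WithLp.toLp 2 ![q.1, q.2])| < r},
        f (frameLevel μ K (WithLp.toLp 2 ![q.1, q.2])) * V (levelPoint μ K 0 θ') (WithLp.toLp 2 ![q.1, q.2]) := by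
  simp only [hV]

/-- Every angular derivative of the θ-blind tube tadpole vanishes. -/
theorem iteratedDeriv_tubeTadpole_const_vertex {f : ℝ → ℂ} {V : Momentum → Momentum → ℂ} {V₀ : Momentum → ℂ}
    (hV : ∀ k q, V k q = V₀ q) {j : ℕ} (hj : 1 ≤ j) (θ : ℝ) :
    iteratedDeriv j (fun θ : ℝ =>
        ∫ q in {q : ℝ × ℝ | |q.1| < π ∧ |q.2| < π ∧ |frameLevel μ K (WithLp.toLp 2 ![q.1, q.2])| < r},
          f (frameLevel μ K (WithLp.toLp 2 ![q.1, q.2])) * V (levelPoint μ K 0 θ) (WithLp.toLp 2 ![q.1, q.2])) θ = 0 := by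
  have hfun : (fun θ : ℝ =>
        ∫ q in {q : ℝ × ℝ | |q.1| < π ∧ |q.2| < π ∧ |frameLevel μ K (WithLp.toLp 2 ![q.1, q.2])| < r},
          f (frameLevel μ K (WithLp.toLp 2 ![q.1, q.2])) * V (levelPoint μ K 0 θ) (WithLp.toLp 2 ![q.1, q.2])) =
      fun _ : ℝ => ∫ q in {q : ℝ × ℝ | |q.1| < π ∧ |q.2| < π ∧ |frameLevel μ K (WithLp.toLp 2 ![q.1, q.2])| < r},
          f (frameLevel μ K (WithLp.toLp 2 ![q.1, q.2])) * V₀ (WithLp.toLp 2 ![q.1, q.2]) := by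
    funext θ; simp only [hV]
  rw [hfun, iteratedDeriv_const, if_neg (by omega)]

end Const

section Hartree

variable {a b : ℝ} (B : BandBounds a b) {K : TrigPolyC4v} {A : ℝ}
  (hA : ∀ p : Momentum, ∀ j ≤ 2, ‖iteratedFDeriv ℝ j (frameShift K) p‖ ≤ A) (hADt : 2 * A < B.Dtmin)
  {μ r : ℝ} (hlo : a < μ - r - A) (hhi : μ + r + A < b)
include B hA hADt hlo hhi

/-- **The Hartree value**: for the constant vertex `c` (the bare `U`, times frequency phases) and an odd profile, the tube tadpole is bounded by the
radial ODD-DIFFERENCE of the level density `N_K(ρ) = ∫_{(0,2π]} J(ρ,ϑ) dϑ`: `|N_K(ρ) − N_K(−ρ)| ≤ dJ(ρ)` ⟹ `‖T‖ ≤ ½‖c‖·∫‖f(ρ)‖·dJ(ρ) dρ`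
(with `dJ(ρ) = 2N′·|ρ|`: the `C₀|U|Λ_n²` value law — the slice tadpole sees only the DERIVATIVE of the density of states). -/
theorem norm_tubeTadpole_const_le {f : ℝ → ℂ} (hf : ContDiff ℝ ∞ f) (hfsupp : tsupport f ⊆ Ioo (-r) r) (hodd : ∀ ρ, f (-ρ) = -f ρ)
    (c : ℂ) (θ : ℝ) {dJ : ℝ → ℝ}
    (hJ : ∀ ρ ∈ Ioo (-r) r, |(∫ ϑ in Ioc 0 (2 * π), levelChartJac μ K (ρ, ϑ)) - ∫ ϑ in Ioc 0 (2 * π), levelChartJac μ K (-ρ, ϑ)| ≤ dJ ρ)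
    (hfd : IntegrableOn (fun ρ => ‖f ρ‖ * dJ ρ) (Ioo (-r) r)) :
    ‖∫ q in {q : ℝ × ℝ | |q.1| < π ∧ |q.2| < π ∧ |frameLevel μ K (WithLp.toLp 2 ![q.1, q.2])| < r},
        f (frameLevel μ K (WithLp.toLp 2 ![q.1, q.2])) * (fun _ _ : Momentum => c) (levelPoint μ K 0 θ) (WithLp.toLp 2 ![q.1, q.2])‖ ≤
      (1 / 2) * (‖c‖ * ∫ ρ in Ioo (-r) r, ‖f ρ‖ * dJ ρ) := by
  have hV : ContDiff ℝ ∞ fun x : Momentum × Momentum => (fun _ _ : Momentum => c) x.1 x.2 := contDiff_const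
  have h := norm_tubeTadpole_le_of_odd B hA hADt hlo hhi hf hfsupp hodd hV θ (d := fun ρ => ‖c‖ * dJ ρ) (fun ρ hρ => by
      rw [tubeAngularAvg_const, tubeAngularAvg_const, ← sub_smul, norm_smul, Real.norm_eq_abs, mul_comm]
      exact mul_le_mul_of_nonneg_left (hJ ρ hρ) (norm_nonneg _))
    ((hfd.const_mul ‖c‖).congr (Filter.Eventually.of_forall fun ρ => by simp only; ring))
  refine h.trans (le_of_eq ?_)
  congr 1
  rw [← integral_const_mul]
  exact integral_congr_ae (Filter.Eventually.of_forall fun ρ => by simp only; ring)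

end Hartree

/-! ## §5 The slice symbol IS odd under `(q₀, ξ) ↦ (−q₀, −ξ)` (why `hodd` is met by the carrier's slice, LAYER 1 `klLocalPart_succ_sub_eq`) -/

/-- The resolvent symbol `c/(ξ − i(w+θ))` is odd under the simultaneous flip of frequency shift, frequency and level. -/
theorem resolventFnXi_neg_neg_neg (c θ w ξ : ℝ) : resolventFnXi c (-θ) (-w) (-ξ) = -resolventFnXi c θ w ξ := by
  unfold resolventFnXi
  rw [show (-Complex.I * (((-w) + (-θ) : ℝ) : ℂ) + ((-ξ : ℝ) : ℂ)) = -(-Complex.I * ((w + θ : ℝ) : ℂ) + (ξ : ℂ)) by push_cast; ring, div_neg]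

/-- The slice weight `χ₂((w²+ξ²)/Λ²) − χ₂((w²+ξ²)/Λ′²)` is even in the frequency and in the level. -/
theorem sliceWeightFn_neg_neg (Λ Λ' ξ w : ℝ) : sliceWeightFn Λ Λ' (-ξ) (-w) = sliceWeightFn Λ Λ' ξ w := by
  simp only [sliceWeightFn, even_two.neg_pow]

/-- **The slice symbol of the carrier is ODD under `(q₀, ξ) ↦ (−q₀, −ξ)`** (no frequency shift, as in LAYER 1's
`sliceSymbolFnXi (βL²) 0 Λ_{n+1} Λ_n (w_{p₀}) (ξ)`): `ŝ(−q₀, −ξ) = −ŝ(q₀, ξ)` — the Matsubara pair `p₀ ↔ p₀.rev` supplies the two profiles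
`fp = ŝ(q₀, ·)`, `fm = ŝ(−q₀, ·)` of `norm_tubeTadpole_pair_le` with `fm(−ρ) = −fp(ρ)`. -/
theorem sliceSymbolFnXi_neg_neg (c Λ Λ' w ξ : ℝ) : sliceSymbolFnXi c 0 Λ Λ' (-w) (-ξ) = -sliceSymbolFnXi c 0 Λ Λ' w ξ := by
  unfold sliceSymbolFnXi
  rw [sliceWeightFn_neg_neg, ← neg_zero, resolventFnXi_neg_neg_neg, neg_zero, mul_neg]

/-- At a single frequency the symbol pairs with itself only at `q₀ = 0`; in general the level flip alone conjugates up to the weight: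
`ŝ(q₀, −ξ) = −conj(ŝ(q₀, ξ))`·(real weight) — recorded as the exact identity `ŝ(q₀,−ξ) = −(starRingEnd ℂ) (ŝ(q₀, ξ))`. -/
theorem sliceSymbolFnXi_neg_xi (c Λ Λ' w ξ : ℝ) :
    sliceSymbolFnXi c 0 Λ Λ' w (-ξ) = -(starRingEnd ℂ) (sliceSymbolFnXi c 0 Λ Λ' w ξ) := by
  unfold sliceSymbolFnXi resolventFnXi
  rw [show sliceWeightFn Λ Λ' w (-ξ) = sliceWeightFn Λ Λ' w ξ by simp only [sliceWeightFn, neg_sq]]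
  rw [map_mul, Complex.conj_ofReal, map_div₀, Complex.conj_ofReal, map_add, map_mul, map_neg, Complex.conj_I,
    Complex.conj_ofReal, Complex.conj_ofReal]
  rw [show (-Complex.I * ((w + 0 : ℝ) : ℂ) + ((-ξ : ℝ) : ℂ)) = -(-(-Complex.I) * ((w + 0 : ℝ) : ℂ) + (ξ : ℂ)) by push_cast; ring, div_neg, mul_neg]

end Summit.HubbardSuperconductivity.HubbardSuperconductivity.Theorems.C4a

end
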